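import Summits.BirchSwinnertonDyer.BirchSwinnertonDyer.Theorems.GenusKolyvaginAtTwoPowDvdShaCardAtTwoRTJointCountOverK
import Literature.GroupTheory.FiniteAbelian.CharacterModuleUnitAddCircle
import Literature.NumberTheory.EllipticCurves.Sha
import Mathlib.GroupTheory.Torsion
import Mathlib.Algebra.Module.Torsion.Basic
import Mathlib.NumberTheory.Padics.PadicVal.Basic
import HarnessLib

/-!
# Route `GenusKolyvaginAtTwo`, LINE 18 (L_T `PowDvdShaCardAtTwoRT`, stmt-BirchSwinnertonDyer-23299, ex 23242) — THE K-SIDE COUNT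
# WITHOUT INTERSECTION LOSS: two ladders whose spans are ORTHOGONAL under a pairing exhibit `2^{2M₀}` in `#G · #(U ∩ ker B)`;
# for a LEVEL pairing on `Ш[q]` (Cassels–Tate kernel clause) this is `2^{2M₀} ∣ #Ш(E_K)[2^∞]` — no genus budget, no `U ∩ V`

Seat `bsd-line-gk2-p4` g20 (WIDTH-5 attach, cell `bsd-f1-sign2`), `--supports` the crux L_T (helper; closes nothing).
THEOREMS ONLY (no definition, no named fact, no `sorry`); BSD is not proved by any of this; neither is L_T.

WHY (memo `Cruxes/PowDvdShaCardAtTwoRT/Lines/plus-descent-deep-orthogonality-gk2p4.md`).  Every count on the bus multiplies the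
two exhibited spans, `#U · #V = #(U + V) · #(U ∩ V)` (`…RTJointCountDisjoint`), and at `p = 2` pays `#(U ∩ V) ⊆ A^{τ=+1}[2]` — the
«2 lost bits» of the deep genus regime (memo `plus-descent-deep-onesided.md` §6).  ORTHOGONALITY is cheaper than disjointness: if a
bi-additive `B : G × G → ℚ/ℤ` vanishes on `U × V`, then `u ↦ B(u, ·)` maps `U` to the characters of `G/V`, so
`#U · #V ∣ #G · #(U ∩ ker B)` and `U ∩ V` is NOT charged (§1).  For the level-`q` Cassels–Tate pairing on `Ш[q]` the kernel is
`Ш[q] ∩ qШ ⊆ q·Ш[q²]` (Milne I Lemma 6.17), so `#U · #V ∣ #Ш[q²] ∣ #Ш[2^∞]` (§2–§3).  What is then owed (socket X-ORTH) is the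
VANISHING of the Cassels–Tate pairing between (+)-rung and (−)-rung Kolyvagin classes: McCallum's Prop. 4.7 writes it as a sum of
local Tate pairings at Kolyvagin places between OPPOSITE eigenspaces of the regular `⟨Frob_ℓ⟩`-modules `E(K_λ)/2^k ≅ E[2^k]`,
`H¹(K_λ, E)[2^k]`, and those vanish (at odd `p`: McCallum Lemma 5.3; at `2` on `Δ < 0`: eigenvectors of a regular module are norms).

* §1 `natCard_mul_natCard_dvd_of_forall_apply_eq_zero`: **`#U · #V ∣ #G · #(U ⊓ ker B)`** (`Hom(G/V, ℚ/ℤ) ≅ G/V`, tree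
  `nonempty_addMonoidHom_ratAddCircle_addEquiv`); `forall_mem_closure_apply_eq_zero` (orthogonality passes to spans); ladder form
  `pow_two_mul_sum_dvd_natCard_mul_natCard_inf_ker_of_ladders` (`p^{2Σa} ∣ #G · #(U ⊓ ker B)`).
* §2 `natCard_torsionBy_mul_natCard_ker_dvd_of_level`: the level clause «`B x = 0 ⟹ x ∈ qS`» gives `#S[q] · #ker B ∣ #S[q·q]`;
  `natCard_mul_natCard_dvd_natCard_torsionBy_sq_of_level` (**`#U · #V ∣ #S[q·q]`**), `pow_two_mul_dvd_natCard_torsionBy_sq_of_orthogonal_ladders`.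
* §3 `S = Ш(E/F)`, `q = 2^k`, any bi-additive `B` on `Ш[2^k]` into `ℚ/ℤ` with the level clause (the tree's `ctLevelPairing` has it,
  `IsLevelPairing`): **`pow_two_mul_dvd_natCard_sha_of_orthogonal_ladders`** — `2^{2·M 0} ∣ #Ш(E/F)[2^∞]`, L_T's conclusion VERBATIM
  for `F = K`, `E = W_K`, `M 0 = M₀`; and `…_of_dvd_two` (the (+)-families given UPSTAIRS through `f` with `#(ker f ∩ U₁) ∣ 2` — the
  `δE(K)`-bit — refunded by the evenness of `v₂ #Ш(E/F)[2^∞]`).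

References: [McCallumLMS1991] §4 Prop. 4.7, §5 Lemma 5.3, Thm. 5.4; [MilneADT2006] Ch. I §6 Lemma 6.17; [Kolyvagin1991StructureSha].
-/

set_option autoImplicit false
-- the Theorems namespace of this sub repeats the summit name by design (D-0017 nested layout)
set_option linter.dupNamespace false

noncomputable section

open scoped Classical
open scoped AddSubgroup

universe u v

namespace Summit.BirchSwinnertonDyer.BirchSwinnertonDyer.Theorems.GenusExact.PlusDescent

/-! ## §1 Orthogonal subgroups under a `ℚ/ℤ`-valued pairing: `#U · #V ∣ #G · #(U ∩ ker B)` -/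

section Abstract

variable {G : Type u} [AddCommGroup G]

/-- **Orthogonality passes to spans**: if `B` vanishes on `s × t`, it vanishes on `closure s × closure t`. [folklore] -/
theorem forall_mem_closure_apply_eq_zero {T : Type v} [AddCommGroup T] (B : G →+ G →+ T) (s t : Set G)
    (h : ∀ x ∈ s, ∀ y ∈ t, B x y = 0) :
    ∀ x ∈ AddSubgroup.closure s, ∀ y ∈ AddSubgroup.closure t, B x y = 0 := by
  -- first extend in the second variable, then in the first
  have h1 : ∀ x ∈ s, ∀ y ∈ AddSubgroup.closure t, B x y = 0 := by
    intro x hx y hy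
    induction hy using AddSubgroup.closure_induction with
    | mem y hy => exact h x hx y hy
    | zero => exact map_zero _
    | add y z _ _ hy hz => rw [map_add, hy, hz, add_zero]
    | neg y _ hy => rw [map_neg, hy, neg_zero]
  intro x hx
  induction hx using AddSubgroup.closure_induction with
  | mem x hx => exact h1 x hx
  | zero => intro y _; rw [map_zero, AddMonoidHom.zero_apply]
  | add x z _ _ hx hz => intro y hy; rw [map_add, AddMonoidHom.add_apply, hx y hy, hz y hy, add_zero]
  | neg x _ hx => intro y hy; rw [map_neg, AddMonoidHom.neg_apply, hx y hy, neg_zero]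

/-- `#Hom(H, ℚ/ℤ) = #H` for a finite abelian group (tree `nonempty_addMonoidHom_ratAddCircle_addEquiv`). [folklore] -/
theorem natCard_addMonoidHom_ratAddCircle (H : Type u) [AddCommGroup H] [Finite H] :
    Nat.card (H →+ AddCircle (1 : ℚ)) = Nat.card H := by
  obtain ⟨e⟩ := Literature.GroupTheory.FiniteAbelian.nonempty_addMonoidHom_ratAddCircle_addEquiv H
  exact Nat.card_congr e.toEquiv

/-- **THE ORTHOGONAL COUNT.**  `G` finite abelian, `B : G × G → ℚ/ℤ` bi-additive, `U, V ≤ G` with `B(U, V) = 0`.  Then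
`#U · #V ∣ #G · #(U ⊓ ker B)` (`ker B` = left kernel): `u ↦ B(u, ·)` is a homomorphism `U → Hom(G/V, ℚ/ℤ) ≅ G/V` with kernel
`U ∩ ker B`.  Orthogonality replaces the `#(U ∩ V)` of `…RTJointCountDisjoint` by `#(U ∩ ker B)`. [cite: McCallumLMS1991, §5 Lemma 5.3, Thm. 5.4] -/
theorem natCard_mul_natCard_dvd_of_forall_apply_eq_zero [Finite G] (B : G →+ G →+ AddCircle (1 : ℚ)) (U V : AddSubgroup G)
    (hUV : ∀ u ∈ U, ∀ v ∈ V, B u v = 0) :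
    Nat.card U * Nat.card V ∣ Nat.card G * Nat.card ↥(U ⊓ B.ker) := by
  -- `B u` kills `V` for `u ∈ U`
  have hle : ∀ u : U, V ≤ (B (u : G)).ker := fun u v hv ↦ (AddMonoidHom.mem_ker).mpr (hUV u u.2 v hv)
  -- the character map `ψ : U → Hom(G/V, ℚ/ℤ)`
  let ψ : U →+ (G ⧸ V →+ AddCircle (1 : ℚ)) :=
    { toFun := fun u ↦ QuotientAddGroup.lift V (B (u : G)) (hle u)
      map_zero' := by
        refine AddMonoidHom.ext fun x ↦ QuotientAddGroup.induction_on x fun g ↦ ?_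
        rw [QuotientAddGroup.lift_mk, ZeroMemClass.coe_zero, map_zero, AddMonoidHom.zero_apply, AddMonoidHom.zero_apply]
      map_add' := fun u u' ↦ by
        refine AddMonoidHom.ext fun x ↦ QuotientAddGroup.induction_on x fun g ↦ ?_
        rw [AddMonoidHom.add_apply, QuotientAddGroup.lift_mk, QuotientAddGroup.lift_mk, QuotientAddGroup.lift_mk,
          AddMemClass.coe_add, map_add, AddMonoidHom.add_apply] }
  have hψ : ∀ (u : U) (g : G), ψ u (g : G ⧸ V) = B (u : G) g := fun u g ↦ QuotientAddGroup.lift_mk V (hle u) g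
  -- its kernel is `U ∩ ker B`
  have hker : ∀ u : U, ψ u = 0 ↔ (u : G) ∈ B.ker := by
    intro u
    rw [AddMonoidHom.mem_ker]
    constructor
    · intro h
      refine AddMonoidHom.ext fun g ↦ ?_
      have hx := DFunLike.congr_fun h (g : G ⧸ V)
      rwa [hψ, AddMonoidHom.zero_apply] at hx
    · intro h
      refine AddMonoidHom.ext fun x ↦ QuotientAddGroup.induction_on x fun g ↦ ?_
      rw [hψ, h, AddMonoidHom.zero_apply, AddMonoidHom.zero_apply]
  have hkerEq : ψ.ker = (B.ker).addSubgroupOf U := by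
    ext u
    rw [AddMonoidHom.mem_ker, AddSubgroup.mem_addSubgroupOf]
    exact hker u
  -- `#U = #ker ψ · #im ψ`
  have hU : Nat.card U = Nat.card ψ.ker * Nat.card ψ.range := by
    have e : Nat.card (U ⧸ ψ.ker) = Nat.card ψ.range := Nat.card_congr (QuotientAddGroup.quotientKerEquivRange ψ).toEquiv
    rw [AddSubgroup.card_eq_card_quotient_mul_card_addSubgroup ψ.ker, e, mul_comm]
  -- `#ker ψ = #(U ⊓ ker B)`
  have hK : Nat.card ψ.ker = Nat.card ↥(U ⊓ B.ker) := by
    rw [hkerEq, ← AddSubgroup.inf_addSubgroupOf_left]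
    exact Nat.card_congr (AddSubgroup.addSubgroupOfEquivOfLe (inf_le_left : U ⊓ B.ker ≤ U)).toEquiv
  -- `#im ψ ∣ #Hom(G/V, ℚ/ℤ) = #(G/V)`
  haveI : Finite (G ⧸ V) := Finite.of_surjective _ (QuotientAddGroup.mk'_surjective V)
  have hR : Nat.card ψ.range ∣ Nat.card (G ⧸ V) := by
    rw [← natCard_addMonoidHom_ratAddCircle (G ⧸ V)]
    exact AddSubgroup.card_addSubgroup_dvd_card ψ.range
  -- assemble: `#U · #V = #K · #im ψ · #V ∣ #K · #(G/V) · #V = #K · #G`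
  have hG : Nat.card G = Nat.card (G ⧸ V) * Nat.card V := AddSubgroup.card_eq_card_quotient_mul_card_addSubgroup V
  rw [hU, hK, hG, mul_comm (Nat.card (G ⧸ V) * Nat.card V) _, mul_assoc]
  exact mul_dvd_mul_left _ (mul_dvd_mul_right hR _)

/-- **Two ladders in two ORTHOGONAL subgroups exhibit `p^{2Σ a}` inside `#G · #(U ∩ ker B)`**: `B(U, V) = 0`, and for every
`m < T` there are `2m+2` independent elements of `U` of order `p^{a(2m)}` and of `V` of order `p^{a(2m+1)}`; then
`p^{2 Σ_{j<2T} a j} ∣ #G · #(U ⊓ ker B)` (one-sided counts of `…RTLadderCountTwin`, then §1). [cite: McCallumLMS1991, §5 Thm. 5.4] -/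
theorem pow_two_mul_sum_dvd_natCard_mul_natCard_inf_ker_of_ladders [Finite G] {p : ℕ} (hp : p.Prime) (T : ℕ) (a : ℕ → ℕ)
    (B : G →+ G →+ AddCircle (1 : ℚ)) (U V : AddSubgroup G) (hUV : ∀ u ∈ U, ∀ v ∈ V, B u v = 0)
    (hU : ∀ m < T, ∃ x : Fin (2 * m + 2) → G, (∀ i, x i ∈ U) ∧ (∀ i, addOrderOf (x i) = p ^ a (2 * m)) ∧
      ∀ c : Fin (2 * m + 2) → ℤ, ∑ i, c i • x i = 0 → ∀ i, ((p ^ a (2 * m) : ℕ) : ℤ) ∣ c i)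
    (hV : ∀ m < T, ∃ x : Fin (2 * m + 2) → G, (∀ i, x i ∈ V) ∧ (∀ i, addOrderOf (x i) = p ^ a (2 * m + 1)) ∧
      ∀ c : Fin (2 * m + 2) → ℤ, ∑ i, c i • x i = 0 → ∀ i, ((p ^ a (2 * m + 1) : ℕ) : ℤ) ∣ c i) :
    p ^ (2 * ∑ j ∈ Finset.range (2 * T), a j) ∣ Nat.card G * Nat.card ↥(U ⊓ B.ker) := by
  have hU' : ∀ m < T, ∃ x : Fin (2 * m + 2) → U, (∀ i, addOrderOf (x i) = p ^ a (2 * m)) ∧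
      ∀ c : Fin (2 * m + 2) → ℤ, ∑ i, c i • x i = 0 → ∀ i, ((p ^ a (2 * m) : ℕ) : ℤ) ∣ c i := fun m hm ↦ by
    obtain ⟨x, hmem, hord, hind⟩ := hU m hm
    exact exists_indepFamily_subtype x hmem hord hind
  have hV' : ∀ m < T, ∃ x : Fin (2 * m + 2) → V, (∀ i, addOrderOf (x i) = p ^ a (2 * m + 1)) ∧
      ∀ c : Fin (2 * m + 2) → ℤ, ∑ i, c i • x i = 0 → ∀ i, ((p ^ a (2 * m + 1) : ℕ) : ℤ) ∣ c i := fun m hm ↦ by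
    obtain ⟨x, hmem, hord, hind⟩ := hV m hm
    exact exists_indepFamily_subtype x hmem hord hind
  exact (pow_two_mul_sum_dvd_natCard_mul_of_twinLadder (Ap := U) (Am := V) hp T a hU' hV').trans
    (natCard_mul_natCard_dvd_of_forall_apply_eq_zero B U V hUV)

end Abstract

/-! ## §2 Level pairings: the kernel clause `B x = 0 ⟹ x ∈ qS` bounds the kernel by `#S[q·q]/#S[q]` -/

section Level

variable {S : Type u} [AddCommGroup S] {T : Type v} [AddCommGroup T]

/-- `S[q] ≤ S[q·q]`. [folklore] -/
theorem torsionBy_le_torsionBy_mul_self (q : ℕ) : S[(q : ℤ)] ≤ S[((q * q : ℕ) : ℤ)] := by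
  intro x hx
  rw [AddSubgroup.torsionBy.nsmul_iff] at hx ⊢
  rw [mul_nsmul', hx, nsmul_zero]

/-- **Level kernel bound.**  `S` an abelian group, `q : ℕ`, `B : S[q] × S[q] → T` bi-additive with the Cassels–Tate kernel clause
«`B(x, ·) = 0 ⟹ x = q·z` for some `z ∈ S`» (one direction of the tree's `IsLevelPairing`; Milne I Lemma 6.17).  If `S[q·q]` is
finite then `#S[q] · #ker B ∣ #S[q·q]`: multiplication by `q` maps `S[q·q]` onto `q·S[q·q] ⊇ ker B` with kernel `S[q]`.
[cite: MilneADT2006, Ch. I §6, Lemma 6.17] -/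
theorem natCard_torsionBy_mul_natCard_ker_dvd_of_level (q : ℕ) [Finite ↥(S[((q * q : ℕ) : ℤ)])]
    (B : ↥(S[(q : ℤ)]) →+ ↥(S[(q : ℤ)]) →+ T)
    (hker : ∀ x : ↥(S[(q : ℤ)]), B x = 0 → ∃ z : S, q • z = (x : S)) :
    Nat.card ↥(S[(q : ℤ)]) * Nat.card B.ker ∣ Nat.card ↥(S[((q * q : ℕ) : ℤ)]) := by
  -- `S[q] ≤ S[q·q]`
  have hle := torsionBy_le_torsionBy_mul_self (S := S) q
  haveI : Finite ↥(S[(q : ℤ)]) := Finite.of_injective _ (AddSubgroup.inclusion_injective hle)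
  -- multiplication by `q` on `S[q·q]`, with values in `S[q]`
  let μ : ↥(S[((q * q : ℕ) : ℤ)]) →+ ↥(S[(q : ℤ)]) :=
    { toFun := fun z ↦ ⟨q • (z : S), by
        rw [AddSubgroup.torsionBy.nsmul_iff, ← mul_nsmul']
        exact (AddSubgroup.torsionBy.nsmul_iff).mp z.2⟩
      map_zero' := Subtype.ext (by
        change q • ((0 : ↥(S[((q * q : ℕ) : ℤ)])) : S) = ((0 : ↥(S[(q : ℤ)])) : S)
        rw [ZeroMemClass.coe_zero, ZeroMemClass.coe_zero, nsmul_zero])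
      map_add' := fun z z' ↦ Subtype.ext (by
        change q • ((z : S) + (z' : S)) = q • (z : S) + q • (z' : S)
        exact nsmul_add _ _ _) }
  have hμ : ∀ z : ↥(S[((q * q : ℕ) : ℤ)]), ((μ z : ↥(S[(q : ℤ)])) : S) = q • (z : S) := fun _ ↦ rfl
  -- `ker μ ≃ S[q]`
  have hkerμ : Nat.card μ.ker = Nat.card ↥(S[(q : ℤ)]) := by
    have hk : μ.ker = (S[(q : ℤ)]).addSubgroupOf (S[((q * q : ℕ) : ℤ)]) := by
      ext z
      rw [AddMonoidHom.mem_ker, AddSubgroup.mem_addSubgroupOf, AddSubgroup.torsionBy.nsmul_iff]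
      constructor
      · intro h
        have h' : ((μ z : ↥(S[(q : ℤ)])) : S) = ((0 : ↥(S[(q : ℤ)])) : S) := congrArg Subtype.val h
        rwa [hμ, ZeroMemClass.coe_zero] at h'
      · intro h
        exact Subtype.ext (by rw [hμ, h, ZeroMemClass.coe_zero])
    rw [hk]
    exact Nat.card_congr (AddSubgroup.addSubgroupOfEquivOfLe hle).toEquiv
  -- `ker B ≤ im μ`
  have hKle : B.ker.map (S[(q : ℤ)]).subtype ≤ (μ.range).map (S[(q : ℤ)]).subtype := by
    rintro _ ⟨x, hx, rfl⟩
    obtain ⟨z, hz⟩ := hker x ((AddMonoidHom.mem_ker).mp hx)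
    have hz2 : z ∈ S[((q * q : ℕ) : ℤ)] := by
      rw [AddSubgroup.torsionBy.nsmul_iff, mul_nsmul', hz]
      exact (AddSubgroup.torsionBy.nsmul_iff).mp x.2
    refine ⟨μ ⟨z, hz2⟩, ⟨⟨z, hz2⟩, rfl⟩, ?_⟩
    change ((μ ⟨z, hz2⟩ : ↥(S[(q : ℤ)])) : S) = (x : S)
    rw [hμ, hz]
  have hKdvd : Nat.card B.ker ∣ Nat.card μ.range := by
    have h1 : Nat.card B.ker = Nat.card ↥(B.ker.map (S[(q : ℤ)]).subtype) :=
      Nat.card_congr (AddSubgroup.equivMapOfInjective B.ker _ (S[(q : ℤ)]).subtype_injective).toEquiv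
    have h2 : Nat.card μ.range = Nat.card ↥((μ.range).map (S[(q : ℤ)]).subtype) :=
      Nat.card_congr (AddSubgroup.equivMapOfInjective μ.range _ (S[(q : ℤ)]).subtype_injective).toEquiv
    rw [h1, h2]
    exact AddSubgroup.card_dvd_of_le hKle
  -- `#S[q·q] = #ker μ · #im μ`
  have hμcard : Nat.card ↥(S[((q * q : ℕ) : ℤ)]) = Nat.card μ.ker * Nat.card μ.range := by
    have e : Nat.card (↥(S[((q * q : ℕ) : ℤ)]) ⧸ μ.ker) = Nat.card μ.range :=
      Nat.card_congr (QuotientAddGroup.quotientKerEquivRange μ).toEquiv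
    rw [AddSubgroup.card_eq_card_quotient_mul_card_addSubgroup μ.ker, e, mul_comm]
  rw [hμcard, hkerμ]
  exact mul_dvd_mul_left _ hKdvd

/-- **`#U · #V ∣ #S[q·q]` for orthogonal subgroups of `S[q]` under a level-`q` pairing into `ℚ/ℤ`** (§1 + the kernel bound).
[cite: MilneADT2006, Ch. I §6, Lemma 6.17] [cite: McCallumLMS1991, §5 Thm. 5.4] -/
theorem natCard_mul_natCard_dvd_natCard_torsionBy_sq_of_level (q : ℕ) [Finite ↥(S[((q * q : ℕ) : ℤ)])]
    (B : ↥(S[(q : ℤ)]) →+ ↥(S[(q : ℤ)]) →+ AddCircle (1 : ℚ))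
    (hker : ∀ x : ↥(S[(q : ℤ)]), B x = 0 → ∃ z : S, q • z = (x : S))
    (U V : AddSubgroup ↥(S[(q : ℤ)])) (hUV : ∀ u ∈ U, ∀ v ∈ V, B u v = 0) :
    Nat.card U * Nat.card V ∣ Nat.card ↥(S[((q * q : ℕ) : ℤ)]) := by
  have hle := torsionBy_le_torsionBy_mul_self (S := S) q
  haveI : Finite ↥(S[(q : ℤ)]) := Finite.of_injective _ (AddSubgroup.inclusion_injective hle)
  refine (natCard_mul_natCard_dvd_of_forall_apply_eq_zero B U V hUV).trans ?_
  refine (mul_dvd_mul_left _ (AddSubgroup.card_dvd_of_le (inf_le_right : U ⊓ B.ker ≤ B.ker))).trans ?_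
  exact natCard_torsionBy_mul_natCard_ker_dvd_of_level q B hker

/-- **Orthogonal ladders under a level pairing: `p^{2·M 0} ∣ #S[q·q]`.**  Two ladders (antitone `M`, `M (2T) = 0`, `2m+2` independent
elements of `S[q]` of the prescribed orders at each step) inside subgroups `U, V ≤ S[q]` with `B(U, V) = 0` for a level-`q` pairing `B`.
[cite: McCallumLMS1991, §5 Thm. 5.4] [cite: MilneADT2006, Ch. I §6, Lemma 6.17] -/
theorem pow_two_mul_dvd_natCard_torsionBy_sq_of_orthogonal_ladders (q : ℕ) [Finite ↥(S[((q * q : ℕ) : ℤ)])]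
    (B : ↥(S[(q : ℤ)]) →+ ↥(S[(q : ℤ)]) →+ AddCircle (1 : ℚ))
    (hker : ∀ x : ↥(S[(q : ℤ)]), B x = 0 → ∃ z : S, q • z = (x : S))
    (U V : AddSubgroup ↥(S[(q : ℤ)])) (hUV : ∀ u ∈ U, ∀ v ∈ V, B u v = 0)
    {p : ℕ} (hp : p.Prime) (T : ℕ) (M : ℕ → ℕ) (hM : ∀ j, M (j + 1) ≤ M j) (hMT : M (2 * T) = 0)
    (hU : ∀ m < T, ∃ x : Fin (2 * m + 2) → ↥(S[(q : ℤ)]), (∀ i, x i ∈ U) ∧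
      (∀ i, addOrderOf (x i) = p ^ (M (2 * m) - M (2 * m + 1))) ∧
      ∀ c : Fin (2 * m + 2) → ℤ, ∑ i, c i • x i = 0 → ∀ i, ((p ^ (M (2 * m) - M (2 * m + 1)) : ℕ) : ℤ) ∣ c i)
    (hV : ∀ m < T, ∃ x : Fin (2 * m + 2) → ↥(S[(q : ℤ)]), (∀ i, x i ∈ V) ∧
      (∀ i, addOrderOf (x i) = p ^ (M (2 * m + 1) - M (2 * m + 2))) ∧
      ∀ c : Fin (2 * m + 2) → ℤ, ∑ i, c i • x i = 0 → ∀ i, ((p ^ (M (2 * m + 1) - M (2 * m + 2)) : ℕ) : ℤ) ∣ c i) :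
    p ^ (2 * M 0) ∣ Nat.card ↥(S[((q * q : ℕ) : ℤ)]) := by
  have hle := torsionBy_le_torsionBy_mul_self (S := S) q
  haveI : Finite ↥(S[(q : ℤ)]) := Finite.of_injective _ (AddSubgroup.inclusion_injective hle)
  haveI : Finite U := Finite.of_injective _ U.subtype_injective
  haveI : Finite V := Finite.of_injective _ V.subtype_injective
  have hU' : ∀ m < T, ∃ x : Fin (2 * m + 2) → U, (∀ i, addOrderOf (x i) = p ^ (M (2 * m) - M (2 * m + 1))) ∧
      ∀ c : Fin (2 * m + 2) → ℤ, ∑ i, c i • x i = 0 → ∀ i, ((p ^ (M (2 * m) - M (2 * m + 1)) : ℕ) : ℤ) ∣ c i :=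
    fun m hm ↦ by
      obtain ⟨x, hmem, hord, hind⟩ := hU m hm
      exact exists_indepFamily_subtype x hmem hord hind
  have hV' : ∀ m < T, ∃ x : Fin (2 * m + 2) → V, (∀ i, addOrderOf (x i) = p ^ (M (2 * m + 1) - M (2 * m + 2))) ∧
      ∀ c : Fin (2 * m + 2) → ℤ, ∑ i, c i • x i = 0 → ∀ i, ((p ^ (M (2 * m + 1) - M (2 * m + 2)) : ℕ) : ℤ) ∣ c i :=
    fun m hm ↦ by
      obtain ⟨x, hmem, hord, hind⟩ := hV m hm
      exact exists_indepFamily_subtype x hmem hord hind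
  have h := pow_two_mul_sum_dvd_natCard_mul_of_twinLadder (Ap := U) (Am := V) hp T (fun j ↦ M j - M (j + 1))
    (fun m hm ↦ hU' m hm) (fun m hm ↦ by
      obtain ⟨x, hord, hind⟩ := hV' m hm
      exact ⟨x, fun i ↦ by rw [hord i], fun c hc i ↦ by simpa using hind c hc i⟩)
  rw [sum_range_sub_eq_of_antitone M hM, hMT, Nat.sub_zero] at h
  exact h.trans (natCard_mul_natCard_dvd_natCard_torsionBy_sq_of_level q B hker U V hUV)

end Level

/-! ## §3 L_T's currency: orthogonal ladders in `Ш(E/F)[2^k]` give `2^{2·M 0} ∣ #Ш(E/F)[2^∞]` -/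

section Sha

open WeierstrassCurve

variable {F : Type u} [Field F] [NumberField F] (V : WeierstrassCurve F)

/-- Bookkeeping: `Ш[2^j] ≤ Ш[2^∞]`, so `Ш[2^j]` is finite when `Ш[2^∞]` is and `#Ш[2^j] ∣ #Ш[2^∞]`. [folklore] -/
theorem natCard_sha_torsionBy_two_pow_dvd [Finite (AddCommGroup.primaryComponent V.sha 2)] (j : ℕ) :
    Finite ↥((↥V.sha)[((2 ^ j : ℕ) : ℤ)]) ∧
      Nat.card ↥((↥V.sha)[((2 ^ j : ℕ) : ℤ)]) ∣ Nat.card (AddCommGroup.primaryComponent V.sha 2) := by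
  have hle : (↥V.sha)[((2 ^ j : ℕ) : ℤ)] ≤ AddCommGroup.primaryComponent V.sha 2 := by
    intro x hx
    exact (AddCommGroup.mem_primaryComponent).mpr ⟨j, (AddSubgroup.torsionBy.nsmul_iff).mp hx⟩
  exact ⟨Finite.of_injective _ (AddSubgroup.inclusion_injective hle), AddSubgroup.card_dvd_of_le hle⟩

/-- **ORTHOGONAL KOLYVAGIN SPANS GIVE L_T's CONCLUSION VERBATIM.**  `E/F` an elliptic curve over a number field with `Ш(E/F)[2^∞]`
finite; a level `q = 2^k` and a bi-additive pairing `B : Ш[q] × Ш[q] → ℚ/ℤ` with the Cassels–Tate kernel clause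
«`B(x, ·) = 0 ⟹ x ∈ q·Ш`» (the tree's canonical `ctLevelPairing` at `m = 2^k` is such a `B` over a totally complex `F`:
`isLevelPairing_ctLevelPairing_canonical`); subgroups `U, U′ ≤ Ш[q]` with `B(U, U′) = 0`; an antitone ladder `M` with `M (2T) = 0`;
for each `m < T`, `2m+2` independent classes of `Ш[q]` inside `U` of order `2^{M(2m) − M(2m+1)}` and `2m+2` inside `U′` of order
`2^{M(2m+1) − M(2m+2)}`.  Then **`2^{2·M 0} ∣ #Ш(E/F)[2^∞]`** — for `F = K`, `E = W_K`, `M 0 = M₀` the conclusion of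
`PowDvdShaCardAtTwoRT`, with NO genus budget `ord₂ C(Wd)`, NO Milne identity, NO disjointness of the spans.  Intended `U` / `U′`: the
spans of the (+)- / (−)-rung Kolyvagin classes `2^{L−M_{r−1}}·c_L(n)` (`L = 2k`), whose Cassels–Tate orthogonality is the arithmetic
socket X-ORTH (McCallum Prop. 4.7 + local cross-sign vanishing). [cite: McCallumLMS1991, §4 Prop. 4.7, §5 Thm. 5.4]
[cite: MilneADT2006, Ch. I §6, Lemma 6.17] [cite: Kolyvagin1991StructureSha] -/
theorem pow_two_mul_dvd_natCard_sha_of_orthogonal_ladders [Finite (AddCommGroup.primaryComponent V.sha 2)] (k : ℕ)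
    (B : ↥((↥V.sha)[((2 ^ k : ℕ) : ℤ)]) →+ ↥((↥V.sha)[((2 ^ k : ℕ) : ℤ)]) →+ AddCircle (1 : ℚ))
    (hker : ∀ x : ↥((↥V.sha)[((2 ^ k : ℕ) : ℤ)]), B x = 0 → ∃ z : V.sha, (2 ^ k) • z = (x : V.sha))
    (U U' : AddSubgroup ↥((↥V.sha)[((2 ^ k : ℕ) : ℤ)])) (hUU' : ∀ u ∈ U, ∀ v ∈ U', B u v = 0)
    (T : ℕ) (M : ℕ → ℕ) (hM : ∀ j, M (j + 1) ≤ M j) (hMT : M (2 * T) = 0)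
    (hfam : ∀ m < T, ∃ x : Fin (2 * m + 2) → ↥((↥V.sha)[((2 ^ k : ℕ) : ℤ)]), (∀ i, x i ∈ U) ∧
      (∀ i, addOrderOf (x i) = 2 ^ (M (2 * m) - M (2 * m + 1))) ∧
      ∀ c : Fin (2 * m + 2) → ℤ, ∑ i, c i • x i = 0 → ∀ i, ((2 ^ (M (2 * m) - M (2 * m + 1)) : ℕ) : ℤ) ∣ c i)
    (hfam' : ∀ m < T, ∃ x : Fin (2 * m + 2) → ↥((↥V.sha)[((2 ^ k : ℕ) : ℤ)]), (∀ i, x i ∈ U') ∧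
      (∀ i, addOrderOf (x i) = 2 ^ (M (2 * m + 1) - M (2 * m + 2))) ∧
      ∀ c : Fin (2 * m + 2) → ℤ, ∑ i, c i • x i = 0 → ∀ i, ((2 ^ (M (2 * m + 1) - M (2 * m + 2)) : ℕ) : ℤ) ∣ c i) :
    2 ^ (2 * M 0) ∣ Nat.card (AddCommGroup.primaryComponent V.sha 2) := by
  obtain ⟨hfin, hdvd⟩ := natCard_sha_torsionBy_two_pow_dvd V (k + k)
  have hqq : ((2 ^ k * 2 ^ k : ℕ) : ℤ) = ((2 ^ (k + k) : ℕ) : ℤ) := by rw [← pow_add]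
  haveI : Finite ↥((↥V.sha)[((2 ^ k * 2 ^ k : ℕ) : ℤ)]) := by rw [hqq]; exact hfin
  have h := pow_two_mul_dvd_natCard_torsionBy_sq_of_orthogonal_ladders (S := ↥V.sha) (2 ^ k) B hker U U' hUU'
    Nat.prime_two T M hM hMT hfam hfam'
  rw [hqq] at h
  exact h.trans hdvd

/-- **Variant with the `δE(K)`-bit.**  Same data, except that the (+)-families are only known to exhibit `2^{2Σ_even}` in `#U` UP TO
one bit: they are given through a homomorphism `f : G₁ → Ш[q]` (intended: Selmer group `→ Ш`, kernel `δE(K)/2^L`, meeting the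
(+)-span in `≤ 2` elements) as independent families UPSTAIRS in `U₁ ≤ G₁` with `#(ker f ∩ U₁) ∣ 2` and `f(U₁) ≤ U`; the (−)-families
are given in `Ш[q]` as before.  If `v₂ #Ш(E/F)[2^∞]` is even (Cassels–Tate, tree `isSquare_natCard_primaryComponent_sha`), then still
`2^{2·M 0} ∣ #Ш(E/F)[2^∞]`. [cite: McCallumLMS1991, §5 Thm. 5.4] [cite: Kolyvagin1991StructureSha] -/
theorem pow_two_mul_dvd_natCard_sha_of_orthogonal_ladders_of_dvd_two [Finite (AddCommGroup.primaryComponent V.sha 2)] (k : ℕ)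
    (B : ↥((↥V.sha)[((2 ^ k : ℕ) : ℤ)]) →+ ↥((↥V.sha)[((2 ^ k : ℕ) : ℤ)]) →+ AddCircle (1 : ℚ))
    (hker : ∀ x : ↥((↥V.sha)[((2 ^ k : ℕ) : ℤ)]), B x = 0 → ∃ z : V.sha, (2 ^ k) • z = (x : V.sha))
    (U U' : AddSubgroup ↥((↥V.sha)[((2 ^ k : ℕ) : ℤ)])) (hUU' : ∀ u ∈ U, ∀ v ∈ U', B u v = 0)
    {G₁ : Type u} [AddCommGroup G₁] (f : G₁ →+ ↥((↥V.sha)[((2 ^ k : ℕ) : ℤ)])) (U₁ : AddSubgroup G₁) [Finite U₁]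
    (hfU : U₁.map f ≤ U) (hkerf : Nat.card ↥(f.ker ⊓ U₁) ∣ 2)
    (heven : Even (padicValNat 2 (Nat.card (AddCommGroup.primaryComponent V.sha 2))))
    (T : ℕ) (M : ℕ → ℕ) (hM : ∀ j, M (j + 1) ≤ M j) (hMT : M (2 * T) = 0)
    (hfam : ∀ m < T, ∃ x : Fin (2 * m + 2) → G₁, (∀ i, x i ∈ U₁) ∧
      (∀ i, addOrderOf (x i) = 2 ^ (M (2 * m) - M (2 * m + 1))) ∧
      ∀ c : Fin (2 * m + 2) → ℤ, ∑ i, c i • x i = 0 → ∀ i, ((2 ^ (M (2 * m) - M (2 * m + 1)) : ℕ) : ℤ) ∣ c i)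
    (hfam' : ∀ m < T, ∃ x : Fin (2 * m + 2) → ↥((↥V.sha)[((2 ^ k : ℕ) : ℤ)]), (∀ i, x i ∈ U') ∧
      (∀ i, addOrderOf (x i) = 2 ^ (M (2 * m + 1) - M (2 * m + 2))) ∧
      ∀ c : Fin (2 * m + 2) → ℤ, ∑ i, c i • x i = 0 → ∀ i, ((2 ^ (M (2 * m + 1) - M (2 * m + 2)) : ℕ) : ℤ) ∣ c i) :
    2 ^ (2 * M 0) ∣ Nat.card (AddCommGroup.primaryComponent V.sha 2) := by
  obtain ⟨hfin, hdvd⟩ := natCard_sha_torsionBy_two_pow_dvd V (k + k)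
  have hqq : ((2 ^ k * 2 ^ k : ℕ) : ℤ) = ((2 ^ (k + k) : ℕ) : ℤ) := by rw [← pow_add]
  haveI : Finite ↥((↥V.sha)[((2 ^ k * 2 ^ k : ℕ) : ℤ)]) := by rw [hqq]; exact hfin
  obtain ⟨hfin1, -⟩ := natCard_sha_torsionBy_two_pow_dvd V k
  haveI := hfin1
  haveI : Finite U' := Finite.of_injective _ U'.subtype_injective
  -- one-sided counts: `2^{2Σ_even} ∣ #U₁` upstairs, `2^{2Σ_odd} ∣ #U′` downstairs
  have hU₁' : ∀ m < T, ∃ x : Fin (2 * m + 2) → U₁, (∀ i, addOrderOf (x i) = 2 ^ (M (2 * m) - M (2 * m + 1))) ∧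
      ∀ c : Fin (2 * m + 2) → ℤ, ∑ i, c i • x i = 0 → ∀ i, ((2 ^ (M (2 * m) - M (2 * m + 1)) : ℕ) : ℤ) ∣ c i :=
    fun m hm ↦ by
      obtain ⟨x, hmem, hord, hind⟩ := hfam m hm
      exact exists_indepFamily_subtype x hmem hord hind
  have hV' : ∀ m < T, ∃ x : Fin (2 * m + 2) → U', (∀ i, addOrderOf (x i) = 2 ^ (M (2 * m + 1) - M (2 * m + 2))) ∧
      ∀ c : Fin (2 * m + 2) → ℤ, ∑ i, c i • x i = 0 → ∀ i, ((2 ^ (M (2 * m + 1) - M (2 * m + 2)) : ℕ) : ℤ) ∣ c i :=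
    fun m hm ↦ by
      obtain ⟨x, hmem, hord, hind⟩ := hfam' m hm
      exact exists_indepFamily_subtype x hmem hord hind
  have h := pow_two_mul_sum_dvd_natCard_mul_of_twinLadder (Ap := U₁) (Am := U') Nat.prime_two T (fun j ↦ M j - M (j + 1))
    (fun m hm ↦ hU₁' m hm) (fun m hm ↦ by
      obtain ⟨x, hord, hind⟩ := hV' m hm
      exact ⟨x, fun i ↦ by rw [hord i], fun c hc i ↦ by simpa using hind c hc i⟩)
  rw [sum_range_sub_eq_of_antitone M hM, hMT, Nat.sub_zero] at h
  -- `#U₁ = #(ker f ∩ U₁) · #f(U₁)` and `#f(U₁) ∣ #U`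
  have hU₁ : Nat.card U₁ = Nat.card ↥(f.ker ⊓ U₁) * Nat.card ↥(U₁.map f) := by
    rw [← AddSubgroup.relIndex_ker, ← AddSubgroup.inf_relIndex_right, ← AddSubgroup.relIndex_bot_left (f.ker ⊓ U₁),
      ← AddSubgroup.relIndex_bot_left U₁]
    exact (AddSubgroup.relIndex_mul_relIndex ⊥ (f.ker ⊓ U₁) U₁ bot_le inf_le_right).symm
  have hUV := natCard_mul_natCard_dvd_natCard_torsionBy_sq_of_level (S := ↥V.sha) (2 ^ k) B hker U U' hUU'
  -- assemble: `2^{2M0} ∣ #U₁ · #U′ ∣ 2 · #U · #U′ ∣ 2 · #Ш[q²] ∣ 2 · #Ш[2^∞]`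
  have h2 : 2 ^ (2 * M 0) ∣ 2 * Nat.card (AddCommGroup.primaryComponent V.sha 2) := by
    refine h.trans ?_
    rw [hU₁, mul_assoc]
    refine (mul_dvd_mul hkerf ((mul_dvd_mul_right (AddSubgroup.card_dvd_of_le hfU) _).trans hUV)).trans ?_
    rw [hqq]
    exact mul_dvd_mul_left 2 hdvd
  have hS : Nat.card (AddCommGroup.primaryComponent V.sha 2) ≠ 0 := Nat.card_pos.ne'
  haveI : Fact (Nat.Prime 2) := ⟨Nat.prime_two⟩
  rw [mul_comm 2 (Nat.card (AddCommGroup.primaryComponent V.sha 2))] at h2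
  rw [padicValNat_dvd_iff_le (mul_ne_zero hS two_ne_zero), padicValNat.mul hS two_ne_zero, padicValNat.self one_lt_two] at h2
  rw [padicValNat_dvd_iff_le hS]
  obtain ⟨r, hr⟩ := heven
  omega

end Sha

end Summit.BirchSwinnertonDyer.BirchSwinnertonDyer.Theorems.GenusExact.PlusDescent

end
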